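import Summits.HodgeConjecture.HodgeConjecture.Theorems.F0P3cStCharTSKormanRemarkEight   -- ★ row 25 (F0P2-p02 (g25)): letters `Gqs`, `EllipticData`, `IsLocSmooth`, `𝔇.char`, the `hrep` shape; `char_eq_trace_fixedPoints_of_constOn_coset`
import HarnessLib

/-!
# F0 · P3c · line LH6 «StCharTS» — E1 ROW 52, charter gap (e): the binders `hrep` ∕ `hHC` of ★ 41g-H READ FROM THE (M1∀) PIN `hchar` of the rung-0 junction

Cell `pub/hodgecm-mathlib`, crux H413 = `stmt-HodgeConjecture-24833` (`--supports` lane, helper, THEOREMS ONLY: no definition ∕ instance ∕ notation ∕ named fact ∕ `sorry`).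
Namespace `Summit.HodgeConjecture.HodgeConjecture.Cruxes.H413.F0P3cStCharTSCharPinRep`.  E1 BRICK LEDGER row 52 «`hrep` ∕ `hHC` OF ★ 41g-H FROM THE PINS» (keeper ∕ dealer
F0P3a-p03 (g30) 03:01:38Z → F0P2-p06 (g22); census `F0/P2/F0P2-p06/g22/r52/CENSUS-R52.v1.F0P2p06g22.md` 2700de0803138cca).  HONEST LABEL: count-neutral datum helper (pin
readings; nothing printed is asserted); (R-SS) banked as the PAYDOWN-UNR road for K1 only; E1 = PRINT until the keeper's charter test; HC_CM is proved only modulo the 7 printed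
citations (2 remaining named inputs hLiu418 = stmt-HodgeConjecture-24832, h413 = stmt-HodgeConjecture-24833) until rung 0 closes.

THE PIN.  The (M1∀) letter `hchar` of the rung-0 junction (★ `F0P3cStCharTSDatumJunction13` :134–:136, VERBATIM): for every class `π` of `U(Φ₃)(L⁺_v) = Gqs L v`,
`𝔇.char π` is measurable, locally integrable for `𝔇.μG`, LOCALLY CONSTANT at every `x ∈ 𝔇.regG`, and REPRESENTS the distribution character on `C_c^∞`:
`π.smoothTrace 𝔇.μG φ = ∫ φ · 𝔇.char π ∂𝔇.μG` for every `IsLocSmooth φ` ([Rogawski1990, §12.5 pp. 182–183: «`χ_π` is a locally integrable function, locally constant on `G^r`»];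
[HarishChandra1970]).  ★ 41g-H `F0P3cStCharTSCharacterEllipticUniform.char_eq_fixedVertexSum_sub_fixedEdgeSum` (the (SS-K) UNIFORM character formula at the datum) carries two
of these clauses HYPOTHESIS-STYLE at `π := IrrClass.mk r`: `hrep` (:264) and `hHC` (`∀ᶠ g in nhds γ, 𝔇.char (IrrClass.mk r) g = 𝔇.char (IrrClass.mk r) γ`).  This file READS them
from the pin (charter gap (e) of the keeper's CHARTER TEST v1): one projection each, plus the two remaining conjuncts named, plus Korman's coset-constancy shape `hconst` of
★ row 25 derived from `hHC` on the non-archimedean locally compact `Gqs L v`, and ★ row 25 §1 with `hrep` discharged.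
* §1 (e1) **`smoothTrace_eq_integral_char_of_pin`** = `hrep`; (e2) **`eventually_char_eq_of_pin`** = `hHC` (`γ ∈ 𝔇.regG`); (e3) `measurable_char_of_pin`; (e4) `locallyIntegrable_char_of_pin`.
* §2 (e5) **`exists_subgroup_constOn_coset_of_pin`**: for `γ ∈ 𝔇.regG` there is a compact open subgroup `U` with `𝔇.char (IrrClass.mk r) (γ x) = 𝔇.char (IrrClass.mk r) γ` for all
  `x ∈ U` (★ `nonarchimedeanGroup_unitaryGroupOfForm_local`, instance `locallyCompactSpace_cmDatum_local`); (e6) **`char_eq_trace_fixedPoints_of_pin`** = ★ KORMAN R8 §1 with `hrep`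
  read from the pin.
CONSUMER LINE (41g-H at the pins): `hrep := smoothTrace_eq_integral_char_of_pin L v 𝔇 hchar r`, `hHC := eventually_char_eq_of_pin L v 𝔇 hchar r hγ`.

## References
* [Rogawski1990] J. D. Rogawski, *Automorphic Representations of Unitary Groups in Three Variables*, Ann. of Math. Stud. 123 (1990), §12.5 pp. 182–183 (characters as locally
  integrable functions, locally constant on the regular set).
* [HarishChandra1970] Harish-Chandra (notes by G. van Dijk), *Harmonic Analysis on Reductive p-adic Groups*, LNM 162 (1970), Part III (the character as a function).
* [Korman2004] J. Korman, *A character formula for compact elements (the rank one case)*, arXiv:math/0409292, Remark 8.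
* [SchneiderStuhler1997] P. Schneider, U. Stuhler, *Representation theory and sheaves on the Bruhat–Tits building*, Publ. Math. IHÉS 85 (1997), Ch. III §4.
-/

set_option autoImplicit false

set_option linter.dupNamespace false

noncomputable section

open NumberField IsDedekindDomain MeasureTheory Filter Topology
open scoped Pointwise
open Literature.NumberTheory.Rogawski1990 Literature.NumberTheory.Rogawski1990.Ch12Sec5
open Literature.NumberTheory.Automorphic Literature.NumberTheory.Automorphic.UnitaryGroup

namespace Summit.HodgeConjecture.HodgeConjecture.Cruxes.H413.F0P3cStCharTSCharPinRep

open Summit.HodgeConjecture.HodgeConjecture.Cruxes.H413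

variable (L : Type) [Field L] [NumberField L] [IsCMField L] (v : HeightOneSpectrum (𝓞 ↥(maximalRealSubfield L)))
  [MeasurableSpace (Gqs L v)]
  [∀ γ : Gqs L v, MeasurableSpace (Gqs L v ⧸ Subgroup.centralizer ({γ} : Set (Gqs L v)))]
  [MeasurableSpace (Gqs L v ⧸ Subgroup.center (Gqs L v))]
  {H : Type} [Group H] [TopologicalSpace H] [IsTopologicalGroup H] [MeasurableSpace H]
  (𝔇 : EllipticData (Gqs L v) H)
  (hchar : ∀ π : IrrClass (Gqs L v), Measurable (𝔇.char π) ∧ LocallyIntegrable (𝔇.char π) 𝔇.μG ∧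
      (∀ x ∈ 𝔇.regG, ∀ᶠ y in 𝓝 x, 𝔇.char π y = 𝔇.char π x) ∧
      ∀ φ : Gqs L v → ℂ, IsLocSmooth φ → π.smoothTrace 𝔇.μG φ = ∫ x, φ x * 𝔇.char π x ∂𝔇.μG)

/-! ## §1 The four conjuncts of the pin, named (at `π := IrrClass.mk r` where 41g-H wants them) -/

include hchar in
/-- **(e1) `hrep` OF ★ 41g-H FROM THE PIN**: `𝔇.char (IrrClass.mk r)` represents the distribution character of `r` on `C_c^∞(Gqs L v)` — the fourth conjunct of the (M1∀) pin `hchar`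
at `π := IrrClass.mk r`, in the binder shape of ★ `char_eq_fixedVertexSum_sub_fixedEdgeSum` :264 verbatim. [cite: Rogawski1990, §12.5 pp. 182–183] -/
theorem smoothTrace_eq_integral_char_of_pin (r : SmoothIrrep (Gqs L v)) :
    ∀ φ : Gqs L v → ℂ, IsLocSmooth φ → (IrrClass.mk r).smoothTrace 𝔇.μG φ = ∫ x, φ x * 𝔇.char (IrrClass.mk r) x ∂𝔇.μG :=
  (hchar (IrrClass.mk r)).2.2.2

include hchar in
/-- **(e2) `hHC` OF ★ 41g-H FROM THE PIN**: at a REGULAR `γ` (`γ ∈ 𝔇.regG`) the character `𝔇.char (IrrClass.mk r)` is locally constant: `∀ᶠ g in nhds γ, 𝔇.char (IrrClass.mk r) g =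
𝔇.char (IrrClass.mk r) γ` — the third conjunct of the pin at `π := IrrClass.mk r`, `x := γ`. [cite: Rogawski1990, §12.5 pp. 182–183] -/
theorem eventually_char_eq_of_pin (r : SmoothIrrep (Gqs L v)) {γ : Gqs L v} (hγ : γ ∈ 𝔇.regG) :
    ∀ᶠ g in nhds γ, 𝔇.char (IrrClass.mk r) g = 𝔇.char (IrrClass.mk r) γ :=
  (hchar (IrrClass.mk r)).2.2.1 γ hγ

include hchar in
/-- (e3) The first conjunct of the pin, named: `𝔇.char π` is measurable. [cite: Rogawski1990, §12.5 pp. 182–183] -/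
theorem measurable_char_of_pin (π : IrrClass (Gqs L v)) : Measurable (𝔇.char π) :=
  (hchar π).1

include hchar in
/-- (e4) The second conjunct of the pin, named: `𝔇.char π` is locally integrable for `𝔇.μG`. [cite: Rogawski1990, §12.5 pp. 182–183] -/
theorem locallyIntegrable_char_of_pin (π : IrrClass (Gqs L v)) : LocallyIntegrable (𝔇.char π) 𝔇.μG :=
  (hchar π).2.1

/-! ## §2 Korman's coset-constancy shape from the pin, and ★ KORMAN R8 §1 with `hrep` discharged -/

include hchar in
/-- **(e5) THE `hconst` SHAPE OF ★ KORMAN R8 FROM THE PIN.**  At a regular `γ` there is a COMPACT OPEN subgroup `U ≤ Gqs L v` on whose right coset `γU` the character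
`𝔇.char (IrrClass.mk r)` is constant: `U(Φ₃)(L⁺_v)` is non-archimedean (★ `nonarchimedeanGroup_unitaryGroupOfForm_local`), so the neighbourhood `(γ · )⁻¹{g | char g = char γ} ∩ K` of
`1` (`K` a compact neighbourhood of `1`, `Gqs L v` locally compact) contains an open subgroup, which is closed, hence compact. [cite: Korman2004, Remark 8]
[cite: Rogawski1990, §12.5 pp. 182–183] -/
theorem exists_subgroup_constOn_coset_of_pin (r : SmoothIrrep (Gqs L v)) {γ : Gqs L v} (hγ : γ ∈ 𝔇.regG) :
    ∃ U : Subgroup (Gqs L v), IsOpen (U : Set (Gqs L v)) ∧ IsCompact (U : Set (Gqs L v)) ∧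
      ∀ x ∈ U, 𝔇.char (IrrClass.mk r) (γ * x) = 𝔇.char (IrrClass.mk r) γ := by
  haveI : NonarchimedeanGroup (Gqs L v) :=
    nonarchimedeanGroup_unitaryGroupOfForm_local (E := L) (c := IsCMField.complexConj L) (N := 3) (v := v) (J' := (adelicForm L 3 (qsForm L)).map (adeleToLocal L v))
  -- the set where the character takes the value at `γ` is a neighbourhood of `γ`; pull it back to `1` along `x ↦ γ * x`
  have hS : {g : Gqs L v | 𝔇.char (IrrClass.mk r) g = 𝔇.char (IrrClass.mk r) γ} ∈ 𝓝 γ := eventually_char_eq_of_pin L v 𝔇 hchar r hγ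
  have hcont : Tendsto (fun x : Gqs L v => γ * x) (𝓝 1) (𝓝 γ) := by
    have h := (continuous_const_mul γ).tendsto (1 : Gqs L v)
    rwa [mul_one] at h
  have hT : (fun x : Gqs L v => γ * x) ⁻¹' {g : Gqs L v | 𝔇.char (IrrClass.mk r) g = 𝔇.char (IrrClass.mk r) γ} ∈ 𝓝 (1 : Gqs L v) := hcont hS
  -- a compact neighbourhood of `1`
  obtain ⟨K, hKc, hKmem⟩ := exists_compact_mem_nhds (1 : Gqs L v)
  obtain ⟨V, hV⟩ := NonarchimedeanGroup.is_nonarchimedean _ (Filter.inter_mem hT hKmem)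
  refine ⟨V.toSubgroup, V.isOpen, hKc.of_isClosed_subset V.isClosed (fun x hx => (hV hx).2), fun x hx => ?_⟩
  exact (hV hx).1

/-- **(e6) ★ KORMAN R8 §1 AT THE PINS**: `𝔇.char (IrrClass.mk r) γ = tr(r.ρ γ | V^U)` for `U` compact open normalised by `γ` on whose coset `γU` the character is constant —
★ `F0P3cStCharTSKormanRemarkEight.char_eq_trace_fixedPoints_of_constOn_coset` with its `hrep` hypothesis READ from the pin (e1). [cite: Korman2004, Remark 8]
[cite: SchneiderStuhler1997, Ch. III §4] [cite: Rogawski1990, §12.5 pp. 182–183] -/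
theorem char_eq_trace_fixedPoints_of_pin [BorelSpace (Gqs L v)]
    (hns : ∀ w : PlacesOver L v, IsCMField.complexConj L • w.1 = w.1)
    (νQv : Measure (Gqs L v)) [νQv.IsHaarMeasure] (hμG : 𝔇.μG = νQv)
    (hchar : ∀ π : IrrClass (Gqs L v), Measurable (𝔇.char π) ∧ LocallyIntegrable (𝔇.char π) 𝔇.μG ∧
      (∀ x ∈ 𝔇.regG, ∀ᶠ y in 𝓝 x, 𝔇.char π y = 𝔇.char π x) ∧
      ∀ φ : Gqs L v → ℂ, IsLocSmooth φ → π.smoothTrace 𝔇.μG φ = ∫ x, φ x * 𝔇.char π x ∂𝔇.μG)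
    (r : SmoothIrrep (Gqs L v))
    {U : Subgroup (Gqs L v)} (hUo : IsOpen (U : Set (Gqs L v))) (hUc : IsCompact (U : Set (Gqs L v)))
    {γ : Gqs L v} (hγ : γ ∈ Subgroup.normalizer (U : Set (Gqs L v)))
    (hconst : ∀ x ∈ U, 𝔇.char (IrrClass.mk r) (γ * x) = 𝔇.char (IrrClass.mk r) γ) :
    𝔇.char (IrrClass.mk r) γ =
      LinearMap.trace ℂ (r.ρ.fixedPoints U) ((r.ρ γ).restrict (r.ρ.apply_mem_fixedPoints_of_mem_normalizer hγ)) :=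
  F0P3cStCharTSKormanRemarkEight.char_eq_trace_fixedPoints_of_constOn_coset L v hns νQv 𝔇 hμG r
    (smoothTrace_eq_integral_char_of_pin L v 𝔇 hchar r) hUo hUc hγ hconst

end Summit.HodgeConjecture.HodgeConjecture.Cruxes.H413.F0P3cStCharTSCharPinRep

end
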